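import Mathlib
import HarnessLib
import Literature.MathematicalPhysics.QuantumLattice.SalmhoferCutoffGevrey
import Summits.HubbardSuperconductivity.HubbardSuperconductivity.Theorems.KLProgrammeSmoothTransitionCauchyTable
import Summits.HubbardSuperconductivity.HubbardSuperconductivity.Theorems.KLProgrammeSmoothTransitionCauchyPieces

/-!
# Route `KLProgramme` — engine support (cell gate-hubbard-kl, #22a (2e) «sharp χ₂ table», seat p2 g18): the SHARPENED Cauchy table —
# `|smoothTransition^{(n)}(x)| ≤ 5·n!·(199n/99)ⁿ·e^{−n}` for every `n ≥ 6`, and the rows `n = 3, 4, 5`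

With the three-arc pieces of `…KLProgrammeSmoothTransitionCauchyPieces` on `[3/20, ½]` (envelope `stPieceEnv`) and the scaling discs of
`…KLProgrammeSmoothTransitionCauchyTable` on `(0, 3/20]` (constant `≤ 5`), the middle-region term `2·(15/2)ⁿ` of the first table disappears:
for `n ≥ 6` the piece envelope is below the scaling term (`n ≥ 10`: `M_p ≤ 4`, `r_p ≥ 29/200`, `200/29 < 1990/(99e)`; `6 ≤ n ≤ 9`: sixty-four
rational checks), whence the ONE-TERM table **`abs_iteratedDeriv_smoothTransition_le_cauchy_sharp`**: `|σ^{(n)}(x)| ≤ 5·n!·(199n/99)ⁿ·e^{−n}`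
(`n ≥ 6`, all `x`; within a factor `5.7 … 8.2` of the truth for `6 ≤ n ≤ 12`, asymptotically `≍ (n!)²·2.01ⁿ/√n`-sharp), and the rows
`|σ‴| ≤ 1245`, `|σ⁗| ≤ 20740`, `|σ^{(5)}| ≤ 553800` (truth `110.6`, `2280`, `77193`; the first table had `5391`, `161100`, `6.11·10⁶`).
For Salmhofer's cutoff `χ₂ = σ((4·−1)/3)`: **`norm_iteratedFDeriv_salmhoferCutoff_le_cauchy_sharp`** (`× (4/3)ⁿ`) and the three rows.
Pure real analysis; nothing about the model.  References: Krantz–Parks 2002 Prop. 2.2.10 [cite: KrantzParks2002]; Salmhofer 1999 §4.2.5 (4.71);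
[cite: BenfattoGiulianiMastropietro2006] §2.2 (2.9).
-/

noncomputable section

namespace Summit.HubbardSuperconductivity.HubbardSuperconductivity.Theorems.KLRegimeSplit

set_option linter.dupNamespace false -- summit = problem name (single-conjunct summit), D-0017

open Set Literature.MathematicalPhysics.QuantumLattice
open scoped Nat

/-! ## §1 The piece envelope is below the scaling term for `n ≥ 6` -/

/-- Generic domination for `n ≥ 10`: `M/rⁿ ≤ 5·(199n/99)ⁿ·(10¹⁰/27182818286)ⁿ` when `M ≤ 4`, `r ≥ 29/200`. -/
theorem piece_val_le_scaling_of_ten_le {M r : ℝ} (hM : M ≤ 4) (hr : (29 / 200 : ℝ) ≤ r) {n : ℕ} (hn : 10 ≤ n) :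
    M / r ^ n ≤ 5 * ((199 / 99 : ℝ) * n) ^ n * (10000000000 / 27182818286 : ℝ) ^ n := by
  have hr0 : 0 < r := by linarith
  have hn' : (10 : ℝ) ≤ n := by exact_mod_cast hn
  have h1 : M / r ^ n ≤ 4 * (200 / 29 : ℝ) ^ n := by
    rw [div_le_iff₀ (pow_pos hr0 n)]
    calc M ≤ 4 * 1 := by linarith
      _ ≤ 4 * ((200 / 29 : ℝ) ^ n * r ^ n) := by
          gcongr
          rw [← mul_pow]
          exact one_le_pow₀ (by nlinarith)
      _ = 4 * (200 / 29 : ℝ) ^ n * r ^ n := by ring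
  have h2 : (200 / 29 : ℝ) ^ n ≤ ((199 / 99 : ℝ) * n * (10000000000 / 27182818286 : ℝ)) ^ n := by
    apply pow_le_pow_left₀ (by norm_num)
    nlinarith
  calc M / r ^ n ≤ 4 * (200 / 29 : ℝ) ^ n := h1
    _ ≤ 5 * ((199 / 99 : ℝ) * n * (10000000000 / 27182818286 : ℝ)) ^ n := by
        have : (0 : ℝ) ≤ (200 / 29 : ℝ) ^ n := by positivity
        nlinarith [h2]
    _ = 5 * ((199 / 99 : ℝ) * n) ^ n * (10000000000 / 27182818286 : ℝ) ^ n := by rw [mul_pow]; ring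

/-- **`stPieceEnv n ≤ 5·(199n/99)ⁿ·(10¹⁰/27182818286)ⁿ` for `n ≥ 6`.** -/
theorem stPieceEnv_le_scaling {n : ℕ} (hn : 6 ≤ n) :
    stPieceEnv n ≤ 5 * ((199 / 99 : ℝ) * n) ^ n * (10000000000 / 27182818286 : ℝ) ^ n := by
  rcases le_or_gt 10 n with h10 | h10
  · simp only [stPieceEnv, max_le_iff]
    refine ⟨?_, ?_, ?_, ?_, ?_, ?_, ?_, ?_, ?_, ?_, ?_, ?_, ?_, ?_, ?_, ?_⟩ <;>
      exact piece_val_le_scaling_of_ten_le (by norm_num) (by norm_num) h10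
  · interval_cases n <;> simp only [stPieceEnv, max_le_iff] <;> norm_num

/-- `(10¹⁰/27182818286)ⁿ ≤ e^{−n}`. -/
theorem stC_rat_pow_le_exp_neg (n : ℕ) : (10000000000 / 27182818286 : ℝ) ^ n ≤ Real.exp (-n) := by
  rw [show (-(n : ℝ)) = n * (-1) by ring, Real.exp_nat_mul]
  apply pow_le_pow_left₀ (by norm_num)
  rw [Real.exp_neg]
  calc (10000000000 / 27182818286 : ℝ) = (2.7182818286 : ℝ)⁻¹ := by norm_num
    _ ≤ (Real.exp 1)⁻¹ := inv_anti₀ (Real.exp_pos 1) Real.exp_one_lt_d9.le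

/-! ## §2 The one-term table for `n ≥ 6` -/

/-- The scaling-disc bound on `(0, 3/20]` in the final currency: `|σ^{(n)}(y)| ≤ 5·n!·(199n/99)ⁿ·e^{−n}`. -/
theorem abs_iteratedDeriv_smoothTransition_le_scaling_num {y : ℝ} (hy0 : 0 < y) (hy1 : y ≤ 3 / 20) (n : ℕ) :
    |iteratedDeriv n Real.smoothTransition y| ≤ 5 * n ! * ((199 / 99 : ℝ) * n) ^ n * Real.exp (-n) := by
  have h := abs_iteratedDeriv_smoothTransition_le_scaling (ρ := 99 / 100) (x₁ := 3 / 20) (by norm_num) (by norm_num) hy0 hy1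
    (by norm_num) n
  have hK := smoothTransition_scaling_const_le_five
  calc |iteratedDeriv n Real.smoothTransition y|
      ≤ n ! * ((1 + 99 / 100) / (99 / 100)) ^ n * (n : ℝ) ^ n * Real.exp (-n) *
          (Real.exp (1 - (1 + 99 / 100 : ℝ) * (3 / 20))⁻¹ /
            (1 - Real.exp ((1 - (1 + 99 / 100 : ℝ) * (3 / 20))⁻¹ - ((1 + 99 / 100 : ℝ) * (3 / 20))⁻¹))) := h
    _ ≤ n ! * ((1 + 99 / 100) / (99 / 100)) ^ n * (n : ℝ) ^ n * Real.exp (-n) * 5 := by gcongr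
    _ = 5 * n ! * ((199 / 99 : ℝ) * n) ^ n * Real.exp (-n) := by rw [mul_pow]; norm_num; ring

/-- **THE SHARPENED CAUCHY TABLE**: for every `n ≥ 6` and every real `x`, `|smoothTransition^{(n)}(x)| ≤ 5·n!·(199n/99)ⁿ·e^{−n}`.
[cite: KrantzParks2002, Prop. 2.2.10] -/
theorem abs_iteratedDeriv_smoothTransition_le_cauchy_sharp {n : ℕ} (hn : 6 ≤ n) (x : ℝ) :
    |iteratedDeriv n Real.smoothTransition x| ≤ 5 * n ! * ((199 / 99 : ℝ) * n) ^ n * Real.exp (-n) := by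
  have hT0 : (0 : ℝ) ≤ 5 * n ! * ((199 / 99 : ℝ) * n) ^ n * Real.exp (-n) := by positivity
  refine abs_iteratedDeriv_smoothTransition_le_of_Ioc (by omega) hT0 (fun y hy => ?_) x
  obtain ⟨hy0, hy2⟩ := hy
  by_cases h1 : y ≤ 3 / 20
  · exact abs_iteratedDeriv_smoothTransition_le_scaling_num hy0 h1 n
  · rw [not_le] at h1
    have hp := abs_iteratedDeriv_smoothTransition_le_pieceEnv n ⟨h1.le, hy2⟩
    have he := stC_rat_pow_le_exp_neg n
    calc |iteratedDeriv n Real.smoothTransition y| ≤ n ! * stPieceEnv n := hp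
      _ ≤ n ! * (5 * ((199 / 99 : ℝ) * n) ^ n * (10000000000 / 27182818286 : ℝ) ^ n) := by
          gcongr; exact stPieceEnv_le_scaling hn
      _ ≤ n ! * (5 * ((199 / 99 : ℝ) * n) ^ n * Real.exp (-n)) := by gcongr
      _ = _ := by ring

/-! ## §3 The rows `n = 3, 4, 5` -/

/-- Rows `3, 4, 5` from the cover: `|σ‴| ≤ 1245`, `|σ⁗| ≤ 20740`, `|σ^{(5)}| ≤ 553800`. [cite: KrantzParks2002, Prop. 2.2.10] -/
theorem abs_iteratedDeriv_smoothTransition_le_row_three_four_five {n : ℕ} (hn3 : 3 ≤ n) (hn5 : n ≤ 5) (x : ℝ) :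
    |iteratedDeriv n Real.smoothTransition x| ≤ if n = 3 then 1245 else if n = 4 then 20740 else 553800 := by
  have hT0 : (0 : ℝ) ≤ if n = 3 then 1245 else if n = 4 then 20740 else 553800 := by split_ifs <;> norm_num
  refine abs_iteratedDeriv_smoothTransition_le_of_Ioc (by omega) hT0 (fun y hy => ?_) x
  obtain ⟨hy0, hy2⟩ := hy
  by_cases h1 : y ≤ 3 / 20
  · refine (abs_iteratedDeriv_smoothTransition_le_scaling_num hy0 h1 n).trans ?_
    have he := stC_exp_neg_nat_le n
    calc 5 * (n ! : ℝ) * ((199 / 99 : ℝ) * n) ^ n * Real.exp (-n)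
        ≤ 5 * n ! * ((199 / 99 : ℝ) * n) ^ n * (10000000000 / 27182818283 : ℝ) ^ n := by gcongr
      _ ≤ _ := by interval_cases n <;> norm_num [Nat.factorial]
  · rw [not_le] at h1
    refine (abs_iteratedDeriv_smoothTransition_le_pieceEnv n ⟨h1.le, hy2⟩).trans ?_
    interval_cases n <;> simp only [stPieceEnv] <;> norm_num [Nat.factorial]

/-- `|σ‴(x)| ≤ 1245`. -/
theorem abs_iteratedDeriv_three_smoothTransition_le (x : ℝ) : |iteratedDeriv 3 Real.smoothTransition x| ≤ 1245 := by
  simpa using abs_iteratedDeriv_smoothTransition_le_row_three_four_five (n := 3) (by norm_num) (by norm_num) x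

/-- `|σ⁗(x)| ≤ 20740`. -/
theorem abs_iteratedDeriv_four_smoothTransition_le (x : ℝ) : |iteratedDeriv 4 Real.smoothTransition x| ≤ 20740 := by
  simpa using abs_iteratedDeriv_smoothTransition_le_row_three_four_five (n := 4) (by norm_num) (by norm_num) x

/-- `|σ^{(5)}(x)| ≤ 553800`. -/
theorem abs_iteratedDeriv_five_smoothTransition_le (x : ℝ) : |iteratedDeriv 5 Real.smoothTransition x| ≤ 553800 := by
  simpa using abs_iteratedDeriv_smoothTransition_le_row_three_four_five (n := 5) (by norm_num) (by norm_num) x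

/-! ## §4 The cutoff `χ₂` -/

/-- **Sharpened Cauchy table for `χ₂`**: `‖iteratedFDeriv ℝ n χ₂ x‖ ≤ (4/3)ⁿ·5·n!·(199n/99)ⁿ·e^{−n}` for every `n ≥ 6` and every `x`.
[cite: BenfattoGiulianiMastropietro2006, §2.2 (2.9)] -/
theorem norm_iteratedFDeriv_salmhoferCutoff_le_cauchy_sharp {n : ℕ} (hn : 6 ≤ n) (x : ℝ) :
    ‖iteratedFDeriv ℝ n salmhoferCutoff x‖ ≤ (4 / 3 : ℝ) ^ n * (5 * n ! * ((199 / 99 : ℝ) * n) ^ n * Real.exp (-n)) := by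
  rw [norm_iteratedFDeriv_eq_norm_iteratedDeriv, Real.norm_eq_abs, iteratedDeriv_salmhoferCutoff, abs_mul, abs_pow,
    abs_of_pos (by norm_num : (0 : ℝ) < 4 / 3)]
  exact mul_le_mul_of_nonneg_left (abs_iteratedDeriv_smoothTransition_le_cauchy_sharp hn _) (by positivity)

/-- The `e`-free form for `χ₂`, `n ≥ 6`: `‖Dⁿχ₂ x‖ ≤ (4/3)ⁿ·5·n!·(199n/99)ⁿ·(10¹⁰/27182818283)ⁿ`. [cite: BenfattoGiulianiMastropietro2006, §2.2 (2.9)] -/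
theorem norm_iteratedFDeriv_salmhoferCutoff_le_cauchy_sharp_rat {n : ℕ} (hn : 6 ≤ n) (x : ℝ) :
    ‖iteratedFDeriv ℝ n salmhoferCutoff x‖ ≤ (4 / 3 : ℝ) ^ n * (5 * n ! * ((199 / 99 : ℝ) * n) ^ n * (10000000000 / 27182818283 : ℝ) ^ n) := by
  refine (norm_iteratedFDeriv_salmhoferCutoff_le_cauchy_sharp hn x).trans ?_
  have he := stC_exp_neg_nat_le n
  gcongr

/-- Rows `3, 4, 5` for `χ₂`: `‖D³χ₂‖ ≤ 2952`, `‖D⁴χ₂‖ ≤ 65550`, `‖D⁵χ₂‖ ≤ 2334000` (`(4/3)ⁿ` times the `σ` rows, rounded up).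
[cite: BenfattoGiulianiMastropietro2006, §2.2 (2.9)] -/
theorem norm_iteratedFDeriv_salmhoferCutoff_le_row_three_four_five {n : ℕ} (hn3 : 3 ≤ n) (hn5 : n ≤ 5) (x : ℝ) :
    ‖iteratedFDeriv ℝ n salmhoferCutoff x‖ ≤ if n = 3 then 2952 else if n = 4 then 65550 else 2334000 := by
  rw [norm_iteratedFDeriv_eq_norm_iteratedDeriv, Real.norm_eq_abs, iteratedDeriv_salmhoferCutoff, abs_mul, abs_pow,
    abs_of_pos (by norm_num : (0 : ℝ) < 4 / 3)]
  have h := abs_iteratedDeriv_smoothTransition_le_row_three_four_five hn3 hn5 ((4 / 3 : ℝ) * x - 1 / 3)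
  have h0 : (0 : ℝ) ≤ |iteratedDeriv n Real.smoothTransition ((4 / 3 : ℝ) * x - 1 / 3)| := abs_nonneg _
  interval_cases n <;> norm_num at h ⊢ <;> nlinarith [h, h0]

end Summit.HubbardSuperconductivity.HubbardSuperconductivity.Theorems.KLRegimeSplit

end
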